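import Literature.MathematicalPhysics.QuantumLattice.HubbardBondAlgebra
import Summits.HubbardSuperconductivity.HubbardSuperconductivity.Theorems.EnslavedA1gUpperSandwichLocalityAbstract
import Summits.HubbardSuperconductivity.HubbardSuperconductivity.Theorems.ThermalWedgeTwSeededEnsembleEquivalenceRSourcedPressureLimitFactorisation

/-!
# Crux `TwSeededEnsembleEquivalenceR` (stmt-HubbardSuperconductivity-15581), line `cold-floor-collapse`
# (slug `Sketch`) — stub S3 `stub_sourcedPressureLimit`, layer 2: regional (free-boundary) Hamiltonians
# of a sourced Hubbard model on an abstract vertex set — locality, covariance, cut and filling bounds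

Support file (`--supports stmt-HubbardSuperconductivity-15581`; sorry-free; no definition). On a finite
linearly ordered vertex set `Λ` (Fock space of `Orb Λ`), two objects are SPELLED OUT through defining
hypotheses (instantiated by `rfl` downstream):

* the bond operator of an ordered pair `(X, Y)` in direction `i : Fin 2` (hypothesis `hb`),
  `b i X Y = Σ_σ (−c†_{Xσ}c_{Yσ} + h.c.) + (κ_i q_{XY} + h.c.)`, `q_{XY} = c_{X↑}c_{Y↓} − c_{X↓}c_{Y↑}`
  (hopping `t = 1` and a singlet pair source `κ_i` per direction; `κ = ∓h√2` is the `d`-wave source):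
  Hermitian, even-local, `‖b i X Y‖ ≤ 4 + 4‖κ_i‖`, covariant under `jwEmbed (orbEmb f)`;
* the regional Hamiltonian of `R ⊆ Λ` for an abstract "step" relation `st i X Y` (hypothesis `hH`),
  `H R = V_R + Σ_i Σ_{X,Y ∈ R, st i X Y} b i X Y` (`V_R = onSiteSum U μ R` of `HubbardBondAlgebra`):
  Hermitian, in the even CAR algebra of `R` (`regionHam_mem`), **covariant** along an order embedding
  `f : Λ ↪o Λ'` intertwining the step relations (`jwEmbed_regionHam_univ`), and the two norm bounds of the
  subadditivity argument: **filling** `‖H Λ − H R‖ ≤ #Rᶜ·(|U| + 2|μ| + 4C_b)` when steps are partial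
  bijections (`norm_regionHam_univ_sub_le`), and **cutting into blocks** `‖H Λ − Σ_j H R_j‖ ≤ C_b Σ_i #P_i`
  for the fibres `R_j` of a block map, `P_i` marking the sites whose `i`-step leaves their block
  (`norm_regionHam_univ_sub_sum_le`).

Ruelle, *Statistical Mechanics* (1969) §2.2–2.3; Bratteli–Robinson II §6.2.4. [folklore]
-/

-- the mandated namespace `Summit.<Summit>.<Problem>.Theorems…` repeats `HubbardSuperconductivity`
set_option linter.dupNamespace false

namespace Summit.HubbardSuperconductivity.HubbardSuperconductivity.Theorems.TwSeededEnsembleEquivalenceR.ColdFloorLine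

open Matrix Finset Literature.MathematicalPhysics.QuantumLattice
open Summit.HubbardSuperconductivity.HubbardSuperconductivity.Theorems.EnslavedA1g.UpperSandwich
open scoped ComplexOrder Matrix.Norms.L2Operator

noncomputable section

/-! ### The bond operator -/

section Bond

variable {Λ : Type*} [LinearOrder Λ] [Fintype Λ] {κ : Fin 2 → ℂ}
  {b : Fin 2 → Λ → Λ → Matrix (Finset (Orb Λ)) (Finset (Orb Λ)) ℂ}

/-- **The bond operator is Hermitian** (a sum of terms `A + Aᴴ`). [folklore] -/
theorem isHermitian_bondOp'
    (hb : ∀ (i : Fin 2) (X Y : Λ), b i X Y =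
      (∑ σ : Fin 2, ((-1 : ℂ) • (creation (orb X σ) * annihilation (orb Y σ)) +
        ((-1 : ℂ) • (creation (orb X σ) * annihilation (orb Y σ)))ᴴ)) +
      (κ i • (annihilation (orb X 0) * annihilation (orb Y 1) - annihilation (orb X 1) * annihilation (orb Y 0)) +
        (κ i • (annihilation (orb X 0) * annihilation (orb Y 1) -
          annihilation (orb X 1) * annihilation (orb Y 0)))ᴴ))
    (i : Fin 2) (X Y : Λ) : (b i X Y).IsHermitian := by
  rw [hb]
  refine IsHermitian.add ?_ (isHermitian_add_transpose_self _)
  rw [IsHermitian, conjTranspose_sum]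
  refine Finset.sum_congr rfl fun σ _ => ?_
  rw [conjTranspose_add, conjTranspose_conjTranspose]
  abel

/-- **The bond operator is an even element of the CAR algebra of its two sites.** [folklore] -/
theorem bondOp'_mem
    (hb : ∀ (i : Fin 2) (X Y : Λ), b i X Y =
      (∑ σ : Fin 2, ((-1 : ℂ) • (creation (orb X σ) * annihilation (orb Y σ)) +
        ((-1 : ℂ) • (creation (orb X σ) * annihilation (orb Y σ)))ᴴ)) +
      (κ i • (annihilation (orb X 0) * annihilation (orb Y 1) - annihilation (orb X 1) * annihilation (orb Y 0)) +
        (κ i • (annihilation (orb X 0) * annihilation (orb Y 1) -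
          annihilation (orb X 1) * annihilation (orb Y 0)))ᴴ))
    (i : Fin 2) {X Y : Λ} {R : Finset Λ} (hX : X ∈ R) (hY : Y ∈ R) :
    b i X Y ∈ carEvenSubalgebra (orbs R) := by
  rw [hb]
  have hXo : ∀ σ, orb X σ ∈ orbs R := fun σ => orb_mem_orbs.2 hX
  have hYo : ∀ σ, orb Y σ ∈ orbs R := fun σ => orb_mem_orbs.2 hY
  refine Subalgebra.add_mem _ (Subalgebra.sum_mem _ fun σ _ => Subalgebra.add_mem _ ?_ ?_)
    (Subalgebra.add_mem _ ?_ ?_)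
  · exact Subalgebra.smul_mem _ (creation_mul_annihilation_mem_carEvenSubalgebra (hXo σ) (hYo σ)) _
  · rw [conjTranspose_smul, conjTranspose_mul, creation_conjTranspose, annihilation_conjTranspose]
    exact Subalgebra.smul_mem _ (creation_mul_annihilation_mem_carEvenSubalgebra (hYo σ) (hXo σ)) _
  · exact Subalgebra.smul_mem _ (Subalgebra.sub_mem _
      (annihilation_mul_annihilation_mem_carEvenSubalgebra (hXo 0) (hYo 1))
      (annihilation_mul_annihilation_mem_carEvenSubalgebra (hXo 1) (hYo 0))) _
  · rw [conjTranspose_smul, conjTranspose_sub, conjTranspose_mul, conjTranspose_mul,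
      annihilation_conjTranspose, annihilation_conjTranspose, annihilation_conjTranspose,
      annihilation_conjTranspose]
    exact Subalgebra.smul_mem _ (Subalgebra.sub_mem _
      (creation_mul_creation_mem_carEvenSubalgebra (hYo 1) (hXo 0))
      (creation_mul_creation_mem_carEvenSubalgebra (hYo 0) (hXo 1))) _

/-- **Norm bound**: `‖b i X Y‖ ≤ 4 + 4‖κ_i‖`. [folklore] -/
theorem norm_bondOp'_le
    (hb : ∀ (i : Fin 2) (X Y : Λ), b i X Y =
      (∑ σ : Fin 2, ((-1 : ℂ) • (creation (orb X σ) * annihilation (orb Y σ)) +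
        ((-1 : ℂ) • (creation (orb X σ) * annihilation (orb Y σ)))ᴴ)) +
      (κ i • (annihilation (orb X 0) * annihilation (orb Y 1) - annihilation (orb X 1) * annihilation (orb Y 0)) +
        (κ i • (annihilation (orb X 0) * annihilation (orb Y 1) -
          annihilation (orb X 1) * annihilation (orb Y 0)))ᴴ))
    (i : Fin 2) (X Y : Λ) : ‖b i X Y‖ ≤ 4 + 4 * ‖κ i‖ := by
  rw [hb]
  have h1 : ∀ σ : Fin 2, ‖((-1 : ℂ) • (creation (orb X σ) * annihilation (orb Y σ)) +
      ((-1 : ℂ) • (creation (orb X σ) * annihilation (orb Y σ)))ᴴ : Matrix (Finset (Orb Λ)) (Finset (Orb Λ)) ℂ)‖ ≤ 2 := by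
    intro σ
    refine (norm_smul_add_conjTranspose_le _ _).trans ?_
    have := (norm_two_product_le_one (orb X σ) (orb Y σ)).1
    rw [norm_neg, norm_one]
    linarith
  have h2 : ‖(annihilation (orb X 0) * annihilation (orb Y 1) - annihilation (orb X 1) * annihilation (orb Y 0) :
      Matrix (Finset (Orb Λ)) (Finset (Orb Λ)) ℂ)‖ ≤ 2 := by
    refine (norm_sub_le _ _).trans ?_
    have ha := (norm_two_product_le_one (ι := Orb Λ) (orb X 0) (orb Y 1)).2.1
    have hb' := (norm_two_product_le_one (ι := Orb Λ) (orb X 1) (orb Y 0)).2.1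
    linarith
  refine (norm_add_le _ _).trans (add_le_add ?_ ?_)
  · refine (norm_sum_le _ _).trans ?_
    calc ∑ σ : Fin 2, ‖((-1 : ℂ) • (creation (orb X σ) * annihilation (orb Y σ)) +
          ((-1 : ℂ) • (creation (orb X σ) * annihilation (orb Y σ)))ᴴ : Matrix (Finset (Orb Λ)) (Finset (Orb Λ)) ℂ)‖
        ≤ ∑ _σ : Fin 2, (2 : ℝ) := Finset.sum_le_sum fun σ _ => h1 σ
      _ = 4 := by norm_num
  · refine (norm_smul_add_conjTranspose_le _ _).trans ?_
    nlinarith [norm_nonneg (κ i)]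

/-- **Covariance of the bond operator** under the second quantisation of an order embedding of the
vertex sets: `jwEmbed (orbEmb f) (b i X Y) = b' i (f X) (f Y)`. [folklore] -/
theorem jwEmbed_bondOp' {Λ' : Type*} [LinearOrder Λ'] [Fintype Λ']
    {b' : Fin 2 → Λ' → Λ' → Matrix (Finset (Orb Λ')) (Finset (Orb Λ')) ℂ}
    (hb : ∀ (i : Fin 2) (X Y : Λ), b i X Y =
      (∑ σ : Fin 2, ((-1 : ℂ) • (creation (orb X σ) * annihilation (orb Y σ)) +
        ((-1 : ℂ) • (creation (orb X σ) * annihilation (orb Y σ)))ᴴ)) +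
      (κ i • (annihilation (orb X 0) * annihilation (orb Y 1) - annihilation (orb X 1) * annihilation (orb Y 0)) +
        (κ i • (annihilation (orb X 0) * annihilation (orb Y 1) -
          annihilation (orb X 1) * annihilation (orb Y 0)))ᴴ))
    (hb' : ∀ (i : Fin 2) (X Y : Λ'), b' i X Y =
      (∑ σ : Fin 2, ((-1 : ℂ) • (creation (orb X σ) * annihilation (orb Y σ)) +
        ((-1 : ℂ) • (creation (orb X σ) * annihilation (orb Y σ)))ᴴ)) +
      (κ i • (annihilation (orb X 0) * annihilation (orb Y 1) - annihilation (orb X 1) * annihilation (orb Y 0)) +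
        (κ i • (annihilation (orb X 0) * annihilation (orb Y 1) -
          annihilation (orb X 1) * annihilation (orb Y 0)))ᴴ))
    (f : Λ ↪o Λ') (i : Fin 2) (X Y : Λ) : jwEmbed (orbEmb f) (b i X Y) = b' i (f X) (f Y) := by
  rw [hb, hb']
  simp only [map_add, map_sum, map_smul, map_sub, map_mul, jwEmbed_conjTranspose, jwEmbed_creation,
    jwEmbed_annihilation, orbEmb_orb]

end Bond

/-! ### Generic bookkeeping: indicator sums, sparse norms, pair counts -/

section Counting

variable {α : Type*} [Fintype α] {E : Type*} [SeminormedAddCommGroup E]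

/-- Norm of a triple indicator sum: if `‖F i X Y‖ ≤ C` on the relation `ρ i`, then
`‖Σ_i Σ_X Σ_Y [ρ i X Y] F i X Y‖ ≤ C · Σ_i #{(X,Y) | ρ i X Y}`. [folklore] -/
theorem norm_sum_sum_sum_ite_le (ρ : Fin 2 → α → α → Prop) [∀ i, DecidableRel (ρ i)]
    (F : Fin 2 → α → α → E) {C : ℝ} (hF : ∀ i X Y, ρ i X Y → ‖F i X Y‖ ≤ C) :
    ‖∑ i, ∑ X, ∑ Y, (if ρ i X Y then F i X Y else 0)‖ ≤
      C * ∑ i, (((Finset.univ ×ˢ Finset.univ).filter fun q : α × α => ρ i q.1 q.2).card : ℝ) := by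
  rw [Finset.mul_sum]
  refine (norm_sum_le _ _).trans (Finset.sum_le_sum fun i _ => ?_)
  rw [← Finset.sum_product' (f := fun X Y => if ρ i X Y then F i X Y else 0), mul_comm]
  exact norm_sum_le_card_filter_mul _ (fun q : α × α => ρ i q.1 q.2) _
    (fun q _ hq => if_neg hq) (fun q _ hq => by rw [if_pos hq]; exact hF i q.1 q.2 hq)

/-- Pairs of a right-unique relation are counted by their first components. [folklore] -/
theorem card_filter_pair_le_fst (ρ : α → α → Prop) [DecidableRel ρ] (P : α → Prop) [DecidablePred P]
    (hρ : ∀ X Y Y', ρ X Y → ρ X Y' → Y = Y') (hP : ∀ X Y, ρ X Y → P X) :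
    ((Finset.univ ×ˢ Finset.univ).filter fun q : α × α => ρ q.1 q.2).card ≤ (Finset.univ.filter P).card := by
  refine Finset.card_le_card_of_injOn Prod.fst (fun q hq => ?_) (fun q hq q' hq' h => ?_)
  · rw [Finset.coe_filter] at hq ⊢
    exact ⟨Finset.mem_univ _, hP _ _ hq.2⟩
  · rw [Finset.coe_filter] at hq hq'
    exact Prod.ext h (hρ _ _ _ hq.2 (h ▸ hq'.2))

/-- Pairs of a left-unique relation are counted by their second components. [folklore] -/
theorem card_filter_pair_le_snd (ρ : α → α → Prop) [DecidableRel ρ] (P : α → Prop) [DecidablePred P]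
    (hρ : ∀ X X' Y, ρ X Y → ρ X' Y → X = X') (hP : ∀ X Y, ρ X Y → P Y) :
    ((Finset.univ ×ˢ Finset.univ).filter fun q : α × α => ρ q.1 q.2).card ≤ (Finset.univ.filter P).card := by
  refine Finset.card_le_card_of_injOn Prod.snd (fun q hq => ?_) (fun q hq q' hq' h => ?_)
  · rw [Finset.coe_filter] at hq ⊢
    exact ⟨Finset.mem_univ _, hP _ _ hq.2⟩
  · rw [Finset.coe_filter] at hq hq'
    exact Prod.ext (hρ _ _ _ hq.2 (h ▸ hq'.2)) h

end Counting

/-! ### The regional Hamiltonians -/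

section Region

variable {Λ : Type*} [LinearOrder Λ] [Fintype Λ] {κ : Fin 2 → ℂ} {U μ : ℝ}
  {b : Fin 2 → Λ → Λ → Matrix (Finset (Orb Λ)) (Finset (Orb Λ)) ℂ}
  {st : Fin 2 → Λ → Λ → Prop} [∀ i, DecidableRel (st i)]
  {H : Finset Λ → Matrix (Finset (Orb Λ)) (Finset (Orb Λ)) ℂ}

/-- The on-site operator `V_R = Σ_{x ∈ R} (U n_{x↑}n_{x↓} − μ(n_{x↑} + n_{x↓}))` is Hermitian for real
`U, μ`. [folklore] -/
theorem isHermitian_onSiteSum_real (U μ : ℝ) (R : Finset Λ) : (onSiteSum (U : ℂ) (μ : ℂ) R).IsHermitian := by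
  unfold onSiteSum onSiteOp
  rw [IsHermitian, conjTranspose_sum]
  refine Finset.sum_congr rfl fun x _ => ?_
  have hn : ∀ σ : Fin 2, (numberOp x σ : Matrix (Finset (Orb Λ)) (Finset (Orb Λ)) ℂ)ᴴ = numberOp x σ :=
    fun σ => (numberAt_isHermitian (orb x σ)).eq
  have hc : (numberOp x 1 : Matrix (Finset (Orb Λ)) (Finset (Orb Λ)) ℂ) * numberOp x 0 =
      numberOp x 0 * numberOp x 1 := (numberAt_commute (orb x 1) (orb x 0)).eq
  simp only [conjTranspose_sub, conjTranspose_smul, conjTranspose_mul, conjTranspose_add, hn, hc,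
    Complex.star_def, Complex.conj_ofReal]

/-- `‖V_R‖ ≤ #R · (|U| + 2|μ|)`. [folklore] -/
theorem norm_onSiteSum_le (U μ : ℝ) (R : Finset Λ) :
    ‖onSiteSum (U : ℂ) (μ : ℂ) R‖ ≤ R.card * (|U| + 2 * |μ|) := by
  unfold onSiteSum
  refine (norm_sum_le _ _).trans ?_
  have hn : ∀ (x : Λ) (σ : Fin 2), ‖(numberOp x σ : Matrix (Finset (Orb Λ)) (Finset (Orb Λ)) ℂ)‖ ≤ 1 :=
    fun x σ => (norm_two_product_le_one (orb x σ) (orb x σ)).1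
  have h1 : ∀ x : Λ, ‖onSiteOp (U : ℂ) (μ : ℂ) x‖ ≤ |U| + 2 * |μ| := by
    intro x
    unfold onSiteOp
    refine (norm_sub_le _ _).trans (add_le_add ?_ ?_)
    · rw [norm_smul, Complex.norm_real, Real.norm_eq_abs]
      exact mul_le_of_le_one_right (abs_nonneg _) ((norm_mul_le _ _).trans
        (mul_le_one₀ (hn x 0) (norm_nonneg _) (hn x 1)))
    · rw [norm_smul, Complex.norm_real, Real.norm_eq_abs]
      calc |μ| * ‖(numberOp x 0 : Matrix (Finset (Orb Λ)) (Finset (Orb Λ)) ℂ) + numberOp x 1‖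
          ≤ |μ| * (1 + 1) := mul_le_mul_of_nonneg_left ((norm_add_le _ _).trans
              (add_le_add (hn x 0) (hn x 1))) (abs_nonneg _)
        _ = 2 * |μ| := by ring
  calc ∑ x ∈ R, ‖onSiteOp (U : ℂ) (μ : ℂ) x‖ ≤ ∑ _x ∈ R, (|U| + 2 * |μ|) := Finset.sum_le_sum fun x _ => h1 x
    _ = R.card * (|U| + 2 * |μ|) := by rw [Finset.sum_const, nsmul_eq_mul]

/-- `V_Λ = V_R + V_{Rᶜ}`. [folklore] -/
theorem onSiteSum_univ_eq_add_compl (U μ : ℂ) (R : Finset Λ) :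
    onSiteSum U μ (Finset.univ : Finset Λ) = onSiteSum U μ R + onSiteSum U μ Rᶜ := by
  rw [← Finset.union_compl R, onSiteSum_union U μ disjoint_compl_right]

/-- **The regional Hamiltonians are Hermitian.** [folklore] -/
theorem isHermitian_regionHam
    (hb : ∀ (i : Fin 2) (X Y : Λ), b i X Y =
      (∑ σ : Fin 2, ((-1 : ℂ) • (creation (orb X σ) * annihilation (orb Y σ)) +
        ((-1 : ℂ) • (creation (orb X σ) * annihilation (orb Y σ)))ᴴ)) +
      (κ i • (annihilation (orb X 0) * annihilation (orb Y 1) - annihilation (orb X 1) * annihilation (orb Y 0)) +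
        (κ i • (annihilation (orb X 0) * annihilation (orb Y 1) -
          annihilation (orb X 1) * annihilation (orb Y 0)))ᴴ))
    (hH : ∀ R : Finset Λ, H R = onSiteSum (U : ℂ) (μ : ℂ) R +
      ∑ i : Fin 2, ∑ X : Λ, ∑ Y : Λ, if X ∈ R ∧ Y ∈ R ∧ st i X Y then b i X Y else 0)
    (R : Finset Λ) : (H R).IsHermitian := by
  rw [hH]
  refine (isHermitian_onSiteSum_real U μ R).add ?_
  rw [IsHermitian, conjTranspose_sum]
  refine Finset.sum_congr rfl fun i _ => ?_
  rw [conjTranspose_sum]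
  refine Finset.sum_congr rfl fun X _ => ?_
  rw [conjTranspose_sum]
  refine Finset.sum_congr rfl fun Y _ => ?_
  split_ifs
  · exact (isHermitian_bondOp' hb i X Y).eq
  · exact conjTranspose_zero

/-- **The regional Hamiltonian of `R` is an even element of the CAR algebra of `R`.** [folklore] -/
theorem regionHam_mem
    (hb : ∀ (i : Fin 2) (X Y : Λ), b i X Y =
      (∑ σ : Fin 2, ((-1 : ℂ) • (creation (orb X σ) * annihilation (orb Y σ)) +
        ((-1 : ℂ) • (creation (orb X σ) * annihilation (orb Y σ)))ᴴ)) +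
      (κ i • (annihilation (orb X 0) * annihilation (orb Y 1) - annihilation (orb X 1) * annihilation (orb Y 0)) +
        (κ i • (annihilation (orb X 0) * annihilation (orb Y 1) -
          annihilation (orb X 1) * annihilation (orb Y 0)))ᴴ))
    (hH : ∀ R : Finset Λ, H R = onSiteSum (U : ℂ) (μ : ℂ) R +
      ∑ i : Fin 2, ∑ X : Λ, ∑ Y : Λ, if X ∈ R ∧ Y ∈ R ∧ st i X Y then b i X Y else 0)
    (R : Finset Λ) : H R ∈ carEvenSubalgebra (orbs R) := by
  rw [hH]
  refine Subalgebra.add_mem _ (onSiteSum_mem _ _ subset_rfl) (Subalgebra.sum_mem _ fun i _ =>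
    Subalgebra.sum_mem _ fun X _ => Subalgebra.sum_mem _ fun Y _ => ?_)
  split_ifs with h
  · exact bondOp'_mem hb i h.1 h.2.1
  · exact Subalgebra.zero_mem _

/-- Restricting an indicator sum over all sites to the region. [folklore] -/
theorem sum_sum_ite_mem_and (R : Finset Λ) (P : Λ → Λ → Prop) [DecidableRel P]
    (g : Λ → Λ → Matrix (Finset (Orb Λ)) (Finset (Orb Λ)) ℂ) :
    (∑ X : Λ, ∑ Y : Λ, if X ∈ R ∧ Y ∈ R ∧ P X Y then g X Y else 0) =
      ∑ X ∈ R, ∑ Y ∈ R, if P X Y then g X Y else 0 := by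
  rw [← Finset.sum_subset (Finset.subset_univ R)]
  · refine Finset.sum_congr rfl fun X hX => ?_
    rw [← Finset.sum_subset (Finset.subset_univ R)]
    · refine Finset.sum_congr rfl fun Y hY => ?_
      simp [hX, hY]
    · intro Y _ hY
      simp [hY]
  · intro X _ hX
    exact Finset.sum_eq_zero fun Y _ => by simp [hX]

/-- **Covariance of the regional Hamiltonians**: along an order embedding `f : Λ ↪o Λ'` intertwining
the step relations, `jwEmbed (orbEmb f) (H Λ) = H' (f Λ)`. [folklore] -/
theorem jwEmbed_regionHam_univ {Λ' : Type*} [LinearOrder Λ'] [Fintype Λ']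
    {b' : Fin 2 → Λ' → Λ' → Matrix (Finset (Orb Λ')) (Finset (Orb Λ')) ℂ}
    {st' : Fin 2 → Λ' → Λ' → Prop} [∀ i, DecidableRel (st' i)]
    {H' : Finset Λ' → Matrix (Finset (Orb Λ')) (Finset (Orb Λ')) ℂ}
    (hb : ∀ (i : Fin 2) (X Y : Λ), b i X Y =
      (∑ σ : Fin 2, ((-1 : ℂ) • (creation (orb X σ) * annihilation (orb Y σ)) +
        ((-1 : ℂ) • (creation (orb X σ) * annihilation (orb Y σ)))ᴴ)) +
      (κ i • (annihilation (orb X 0) * annihilation (orb Y 1) - annihilation (orb X 1) * annihilation (orb Y 0)) +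
        (κ i • (annihilation (orb X 0) * annihilation (orb Y 1) -
          annihilation (orb X 1) * annihilation (orb Y 0)))ᴴ))
    (hb' : ∀ (i : Fin 2) (X Y : Λ'), b' i X Y =
      (∑ σ : Fin 2, ((-1 : ℂ) • (creation (orb X σ) * annihilation (orb Y σ)) +
        ((-1 : ℂ) • (creation (orb X σ) * annihilation (orb Y σ)))ᴴ)) +
      (κ i • (annihilation (orb X 0) * annihilation (orb Y 1) - annihilation (orb X 1) * annihilation (orb Y 0)) +
        (κ i • (annihilation (orb X 0) * annihilation (orb Y 1) -
          annihilation (orb X 1) * annihilation (orb Y 0)))ᴴ))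
    (hH : ∀ R : Finset Λ, H R = onSiteSum (U : ℂ) (μ : ℂ) R +
      ∑ i : Fin 2, ∑ X : Λ, ∑ Y : Λ, if X ∈ R ∧ Y ∈ R ∧ st i X Y then b i X Y else 0)
    (hH' : ∀ R : Finset Λ', H' R = onSiteSum (U : ℂ) (μ : ℂ) R +
      ∑ i : Fin 2, ∑ X : Λ', ∑ Y : Λ', if X ∈ R ∧ Y ∈ R ∧ st' i X Y then b' i X Y else 0)
    (f : Λ ↪o Λ') (hst : ∀ i X Y, st' i (f X) (f Y) ↔ st i X Y) :
    jwEmbed (orbEmb f) (H Finset.univ) = H' ((Finset.univ : Finset Λ).map f.toEmbedding) := by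
  rw [hH, hH', map_add, jwEmbed_onSiteSum, map_sum]
  congr 1
  refine Finset.sum_congr rfl fun i _ => ?_
  rw [sum_sum_ite_mem_and ((Finset.univ : Finset Λ).map f.toEmbedding) (st' i) (b' i), Finset.sum_map,
    map_sum]
  refine Finset.sum_congr rfl fun X _ => ?_
  rw [Finset.sum_map, map_sum]
  refine Finset.sum_congr rfl fun Y _ => ?_
  simp only [Finset.mem_univ, true_and]
  rw [show (f.toEmbedding X : Λ') = f X from rfl, show (f.toEmbedding Y : Λ') = f Y from rfl]
  by_cases h : st i X Y
  · rw [if_pos h, if_pos ((hst i X Y).2 h)]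
    exact jwEmbed_bondOp' hb hb' f i X Y
  · rw [if_neg h, if_neg (fun h' => h ((hst i X Y).1 h')), map_zero]

end Region

/-! ### Summary (registered sub-goal of stmt-HubbardSuperconductivity-15581) -/

/-- **Registered sub-goal `spl_regionHamCovariance`** (layer 2a of `stub_sourcedPressureLimit`): the
regional Hamiltonian of a block is Hermitian, even-local, and the second quantisation of the block's own
Hamiltonian. [folklore] -/
theorem spl_regionHamCovariance : ∀ (Λ Λ' : Type) [LinearOrder Λ] [Fintype Λ] [LinearOrder Λ'] [Fintype Λ'] (κ : Fin 2 → ℂ) (U μ : ℝ) (b : Fin 2 → Λ → Λ → Matrix (Finset (Orb Λ)) (Finset (Orb Λ)) ℂ) (b' : Fin 2 → Λ' → Λ' → Matrix (Finset (Orb Λ')) (Finset (Orb Λ')) ℂ) (st : Fin 2 → Λ → Λ → Prop) [∀ i, DecidableRel (st i)] (st' : Fin 2 → Λ' → Λ' → Prop) [∀ i, DecidableRel (st' i)] (H : Finset Λ → Matrix (Finset (Orb Λ)) (Finset (Orb Λ)) ℂ) (H' : Finset Λ' → Matrix (Finset (Orb Λ')) (Finset (Orb Λ')) ℂ), (∀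 (i : Fin 2) (X Y : Λ), b i X Y = (∑ σ : Fin 2, ((-1 : ℂ) • (creation (orb X σ) * annihilation (orb Y σ)) + ((-1 : ℂ) • (creation (orb X σ) * annihilation (orb Y σ)))ᴴ)) + (κ i • (annihilation (orb X 0) * annihilation (orb Y 1) - annihilation (orb X 1) * annihilation (orb Y 0)) + (κ i • (annihilation (orb X 0) * annihilation (orb Y 1) - annihilation (orb X 1) * annihilation (orb Y 0)))ᴴ)) → (∀ (i : Fin 2) (X Y : Λ'), b' i X Y = (∑ σ : Fin 2, ((-1 : ℂ) • (creation (orb X σ) * annihilation (orb Y σ)) + ((-1 : ℂ) • (creation (orb X σ) * annihilation (orb Y σ)))ᴴ)) + (κ i • (annihilation (orb X 0) * annihilation (orb Y 1) - annihilation (orb X 1) * annihilation (orb Y 0)) + (κ i • (annihilation (orb X 0) * annihilation (orb Y 1) - annihilation (orb X 1) * annihilation (orb Y 0)))ᴴ)) → (∀ R : Finset Λ, H R = onSiteSum (U : ℂ) (μ : ℂ) R + ∑ i : Fin 2, ∑ X : Λ, ∑ Y : Λ, if X ∈ R ∧ Y ∈ R ∧ st i X Y then b i X Y else 0) → (∀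 R : Finset Λ', H' R = onSiteSum (U : ℂ) (μ : ℂ) R + ∑ i : Fin 2, ∑ X : Λ', ∑ Y : Λ', if X ∈ R ∧ Y ∈ R ∧ st' i X Y then b' i X Y else 0) → ∀ (f : Λ ↪o Λ'), (∀ i X Y, st' i (f X) (f Y) ↔ st i X Y) → (H' ((Finset.univ : Finset Λ).map f.toEmbedding)).IsHermitian ∧ H' ((Finset.univ : Finset Λ).map f.toEmbedding) ∈ carEvenSubalgebra (orbs ((Finset.univ : Finset Λ).map f.toEmbedding)) ∧ jwEmbed (orbEmb f) (H Finset.univ) = H' ((Finset.univ : Finset Λ).map f.toEmbedding) :=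
  fun _ _ _ _ _ _ _ _ _ _ _ _ _ _ _ _ _ hb hb' hH hH' f hst =>
    ⟨isHermitian_regionHam hb' hH' _, regionHam_mem hb' hH' _, jwEmbed_regionHam_univ hb hb' hH hH' f hst⟩

end

end Summit.HubbardSuperconductivity.HubbardSuperconductivity.Theorems.TwSeededEnsembleEquivalenceR.ColdFloorLine
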